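import Summits.QuantumFields.YangMills.Theorems.BalabanUVNodesN08AlphaEq324RowSuppliers
import Literature.MathematicalPhysics.QuantumFieldTheory.Balaban1983to89.B1Eq324CumulantTaylor

/-!
# Route «BalabanUVNodes», Track-A DAG node N08 = [Balaban1985UV3] Thm 1 p. 257 ∕ Thm 2 p. 272 — THE SUPPLIER SOCKET OF THE SOURCE-FAITHFUL (3.24) ROW:
# `Eq324` bound-weakening and the EXACT `h324` row of `StepAlphaEq324(Core∕CoreLT)` from a per-history sandwich «`0 < ∫_{box} e^{𝒱} dμ` and
# `|log ∫ − Σ_{n≤n̄} cum n∕n!| ≤ E`» with `E` below the booked unit `(Ca+Cc)·(Lᵏg₀²)^{3+κ₀}·|T₁^{(k)}|`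

Cell `pub-ymgap`, seat `pub-ymgap-dag-n08-w4` gen 0 (INTENT-7; last file of the (α)-schema lineage p585687 … p593247).  `bears_on: R4∕N08`; filed
`--supports stmt-QuantumFields-20542` (K1⁷).  THEOREMS ONLY (def-free, sorry-free, standard axioms).

WHY.  After `B1Eq324BenfattoSect5BasicLemma.basicLemmaPrinted_holds` (dag-n08-c p591044 ✓) the [2]-line delivers its conclusion in SANDWICH form
(`B1Eq324BenfattoSpecialisation.abs_log_integral_sub_cumulantSum_le`: `|log ∫ Πχ̂ e^{H_J} dP̂₀ − cumulantSum …| ≤ |I|·errTerm …`, then `errTerm_pFun_le`: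
`|I|·errTerm ≤ C·η^κ·|I|`), and any future GENERALISED lemma over a class of Gaussian lattice fields (this seat's located note `HOME/pub-ymgap-dag-n08-w4/
N08-IDENT-BRIDGE-NOTE.md`) will do the same.  The (α)-row of the edited clauses (`…RowSuppliers` :98, `…Row.StepAlphaEq324.h324`, `…RowCore`, `…RowRange`)
reads `Eq324 (∫ ω in (𝔖 k).box h, e^{𝒱} ∂μ) ((𝔖 k).cum h U) 𝔠.nbar (𝔠.Ca + 𝔠.Cc) (Lᵏ·S.g0sq) (3 + 𝔠.κ₀) (S.sites k)`.  This file is the plug between the two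
shapes, so that on the (α) side nothing has to be re-typed when a supplier lands:
* §1 `Eq324` algebra (not in the tree before): `eq324_mono` (the witness `r` is kept, only the BOUND `C·s^κ·vol ≤ C'·s'^{κ'}·vol'` is weakened),
  `eq324_congr_cum` (cumulant sequences agreeing on `Icc 1 n̄`), `eq324_of_abs_log_le` (sandwich with ANY error `E ≤ C·s^κ·vol` + positivity ⇒ `Eq324`;
  = `B1Eq324CumulantTaylor.eq324_iff_abs_log_sub_le` composed with the weakening).
* §2 ★ `h324Row_of_abs_log_le` — the exact `h324` row at the record's booked constant from a per-(h, U) sandwich with error `E h U ≤ (Ca+Cc)·unit_k`;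
  `h324Row_of_eq324_le` — from any per-(h, U) `Eq324` with constants `(C', s', κ', vol')` whose bound is below the booked one.
HONEST SCOPE.  Real arithmetic over the binder shape; nothing about which supplier is RIGHT for Bałaban's data (the IDENT ∕ generalised-lemma question of the
located note; class II); count-neutral; N08 NOT discharged; nothing continuum ∕ OS ∕ mass gap ∕ Clay — R4 closes the conditional finite-𝕋⁴ rung `BalabanLadder.UV` only.
-/

noncomputable section

namespace Summit.QuantumFields.YangMills.Theorems.BalabanUVNodesN08AlphaEq324RowSocket

open MeasureTheory
open scoped BigOperators Nat
open Literature.MathematicalPhysics.QuantumFieldTheory.Balaban1983to89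
open Literature.MathematicalPhysics.QuantumFieldTheory.Balaban1983to89.B1Sect3Statements (Eq324)
open Literature.MathematicalPhysics.QuantumFieldTheory.Balaban1983to89.B1Eq324CumulantTaylor (eq324_iff_abs_log_sub_le abs_log_sub_le_of_eq324)
open Literature.MathematicalPhysics.QuantumFieldTheory.Balaban1985CMP102.Setting
open Summit.QuantumFields.Balaban3D.Carriers
open Summit.QuantumFields.Balaban3D.Proofs.Primitives (AlphaConsts)
open Summit.QuantumFields.Balaban3D.Proofs.GroupModelLieC (lieC)

/-! ## §1 `Eq324` algebra: bound weakening, cumulant congruence, sandwich form -/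

section Algebra

variable {lhs : ℝ} {cum cum' : ℕ → ℝ} {nbar : ℕ} {C s κ vol C' s' κ' vol' : ℝ}

/-- **BOUND WEAKENING**: an `Eq324` with error budget `C·s^κ·vol` is an `Eq324` with any larger budget `C'·s'^{κ'}·vol'` (same witness `r`).
[cite: Balaban1982Higgs1, (3.24) p.616 (bookkeeping)] -/
theorem eq324_mono (h : Eq324 lhs cum nbar C s κ vol) (hle : C * s ^ κ * vol ≤ C' * s' ^ κ' * vol') : Eq324 lhs cum nbar C' s' κ' vol' := by
  obtain ⟨r, hr, hlhs⟩ := h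
  exact ⟨r, hr.trans hle, hlhs⟩

/-- **CUMULANT CONGRUENCE**: `Eq324` only reads the cumulants `cum n` for `n ∈ Icc 1 n̄`. [cite: Balaban1982Higgs1, (3.24) p.616 (bookkeeping)] -/
theorem eq324_congr_cum (h : Eq324 lhs cum nbar C s κ vol) (hcum : ∀ n ∈ Finset.Icc 1 nbar, cum' n = cum n) : Eq324 lhs cum' nbar C s κ vol := by
  obtain ⟨r, hr, hlhs⟩ := h
  refine ⟨r, hr, ?_⟩
  rw [hlhs]
  congr 2
  exact Finset.sum_congr rfl fun n hn => by rw [hcum n hn]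

/-- **SANDWICH FORM ⇒ `Eq324`**: a positive `lhs` with `|log lhs − Σ_{n=1}^{n̄} cum n∕n!| ≤ E` and `E ≤ C·s^κ·vol` is an `Eq324` with budget `C·s^κ·vol`
(`B1Eq324CumulantTaylor.eq324_iff_abs_log_sub_le` + weakening). [cite: Balaban1982Higgs1, (3.24) p.616] -/
theorem eq324_of_abs_log_le (hlhs : 0 < lhs) {E : ℝ} (hE : |Real.log lhs - ∑ n ∈ Finset.Icc 1 nbar, cum n / (n ! : ℝ)| ≤ E)
    (hle : E ≤ C * s ^ κ * vol) : Eq324 lhs cum nbar C s κ vol :=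
  (eq324_iff_abs_log_sub_le hlhs cum nbar C s κ vol).2 (hE.trans hle)

/-- … and conversely the sandwich with the budget itself (`abs_log_sub_le_of_eq324`, re-exported for the socket's users). [cite: Balaban1982Higgs1, (3.24) p.616] -/
theorem abs_log_le_of_eq324 (h : Eq324 lhs cum nbar C s κ vol) :
    0 < lhs ∧ |Real.log lhs - ∑ n ∈ Finset.Icc 1 nbar, cum n / (n ! : ℝ)| ≤ C * s ^ κ * vol :=
  ⟨h.pos, abs_log_sub_le_of_eq324 h⟩

end Algebra

/-! ## §2 The `h324` row of the edited (α) clauses from a supplier's sandwich -/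

section Row

variable {L : ℕ} {S : Scales L} {G : Type} [GaugeGroup G] [MeasurableSpace G] [HaarData G] (𝔊 : GroupModel G) (𝔠 : AlphaConsts L 𝔊.N)
  (𝔖 : ∀ k, StepSeries S G ↥(lieC 𝔊) (nblkOf S 𝔠.lane.carrier k) k) (k : ℕ)

/-- ★ **THE (3.24) ROW OF THE EDITED CLAUSES FROM A SANDWICH SUPPLIER**: if for every history `h` and field `U` the step's box fluctuation integral is positive
and `|log ∫_{box h} e^{𝒱 h U} dμ − Σ_{n=1}^{n̄} ⟨𝒱ⁿ⟩ᵀ∕n!| ≤ E h U` with `E h U ≤ (Ca + Cc)·(Lᵏg₀²)^{3+κ₀}·|T₁^{(k)}|`, then the row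
`…Row.StepAlphaEq324.h324` ∕ `…RowCore.StepAlphaEq324Core.h324` ∕ `…RowRange.StepAlphaEq324CoreLT.h324` holds VERBATIM.  This is the plug for
`B1Eq324BenfattoSpecialisation.abs_log_integral_sub_cumulantSum_le`-shaped conclusions (and `errTerm_pFun_le` for the budget comparison).
[cite: Balaban1982Higgs1, (3.24) p.616; Balaban1985UV3, (58) p.270] -/
theorem h324Row_of_abs_log_le (E : Hist S.P (k + 1) → GaugeField S.P (k + 1) G → ℝ)
    (hpos : ∀ h (U : GaugeField S.P (k + 1) G), 0 < ∫ ω in (𝔖 k).box h, Real.exp ((𝔖 k).𝒱 h U ω) ∂(𝔖 k).μ)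
    (hsand : ∀ h (U : GaugeField S.P (k + 1) G),
      |Real.log (∫ ω in (𝔖 k).box h, Real.exp ((𝔖 k).𝒱 h U ω) ∂(𝔖 k).μ) - ∑ n ∈ Finset.Icc 1 𝔠.nbar, (𝔖 k).cum h U n / (n ! : ℝ)| ≤ E h U)
    (hE : ∀ h (U : GaugeField S.P (k + 1) G), E h U ≤ (𝔠.Ca + 𝔠.Cc) * ((L : ℝ) ^ k * S.g0sq) ^ (3 + 𝔠.κ₀) * S.sites k) :
    ∀ h (U : GaugeField S.P (k + 1) G),
      Eq324 (∫ ω in (𝔖 k).box h, Real.exp ((𝔖 k).𝒱 h U ω) ∂(𝔖 k).μ) ((𝔖 k).cum h U) 𝔠.nbar (𝔠.Ca + 𝔠.Cc)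
        ((L : ℝ) ^ k * S.g0sq) (3 + 𝔠.κ₀) (S.sites k) :=
  fun h U => eq324_of_abs_log_le (hpos h U) (hsand h U) (hE h U)

/-- **THE (3.24) ROW FROM ANY `Eq324` WITH A SMALLER BUDGET**: a supplier delivering, per `(h, U)`, `Eq324` of the step's box integral with its own constants
`(C' h U, s', κ', vol')` whose budget is below the booked one gives the row (bound weakening `eq324_mono`).
[cite: Balaban1982Higgs1, (3.24) p.616; Balaban1985UV3, (58) p.270] -/
theorem h324Row_of_eq324_le (C' : Hist S.P (k + 1) → GaugeField S.P (k + 1) G → ℝ) (s' κ' vol' : ℝ)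
    (h324' : ∀ h (U : GaugeField S.P (k + 1) G),
      Eq324 (∫ ω in (𝔖 k).box h, Real.exp ((𝔖 k).𝒱 h U ω) ∂(𝔖 k).μ) ((𝔖 k).cum h U) 𝔠.nbar (C' h U) s' κ' vol')
    (hle : ∀ h (U : GaugeField S.P (k + 1) G), C' h U * s' ^ κ' * vol' ≤ (𝔠.Ca + 𝔠.Cc) * ((L : ℝ) ^ k * S.g0sq) ^ (3 + 𝔠.κ₀) * S.sites k) :
    ∀ h (U : GaugeField S.P (k + 1) G),
      Eq324 (∫ ω in (𝔖 k).box h, Real.exp ((𝔖 k).𝒱 h U ω) ∂(𝔖 k).μ) ((𝔖 k).cum h U) 𝔠.nbar (𝔠.Ca + 𝔠.Cc)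
        ((L : ℝ) ^ k * S.g0sq) (3 + 𝔠.κ₀) (S.sites k) :=
  fun h U => eq324_mono (h324' h U) (hle h U)

end Row

end Summit.QuantumFields.YangMills.Theorems.BalabanUVNodesN08AlphaEq324RowSocket

end
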